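import Summits.QuantumFields.YangMills.Theorems.IR.EsPolymerEngineK
import Summits.QuantumFields.YangMills.Theorems.IR.EsPolymerESRungK
import Summits.QuantumFields.YangMills.Theorems.IR.EsPolymerDPRkRefines
import HarnessLib

/-!
# Crux `IR` (stmt-QuantumFields-19354) — LINE «es-polymer-decoupling» (ideator ym-ir-idea-1 g0, lens: graphical-
representation transfer of our CSH / gluing inequalities → gauge FK-type representations)

**The transfer, explicit.**  Edwards–Sokal/FK couple a spin measure to a random edge set so that, GIVEN the edge set,
spins on distinct clusters are independent and conditional means depend only on the own cluster; every correlation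
bound is then a CONNECTIVITY bound on a polymer/percolation gas (CSH, KN, Simon–Lieb all live there).  For
Wilson-action `SU(N)` no positive plaquette-level FK representation exists (REDUCTION-CENSUS §G.5; the tree's
`PlaquetteCovarianceNonneg` refutation 9712/9756 and `Literature.Barriers.QuantumFields.ToronPlaneAnticorrelation`
kill plaquette-local positive association).  The object transferred here is one level up and sign-free: a
**DECOUPLING–POLYMER REPRESENTATION at mesh `b`** (`DPR ρ β S b p`) = a decomposition of the torus Wilson measure
`μ = Σ_Γ ν_Γ` over compatible families `Γ` of cell-polymers such that (I) under each `ν_Γ` block-local observables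
with different OWNER polymers are exactly independent, (D) their `ν_Γ`-means depend on `Γ` only through the owner,
(P) the family law is a hard-core polymer gas `ν_Γ(1) = Z⁻¹ ∏_{γ∈Γ} act γ` with Peierls activities
`act γ ≤ p^{|γ|}`.  At strong coupling and mesh 1 the representation EXISTS by an Edwards–Sokal deletion of cell
Boltzmann factors relative to their flat floor (`W_c = m_c + (W_c − m_c)`, `m_c = e^{−12nβ}`; activities
`≤ (e^{12nβ} − 1)^{|γ|}`) — `stub_esRung` (the deletion step is the Kandel–Domany freeze/delete scheme, a FAITHFUL
representation in Chayes–Machta's sense and available for any bounded local factor — prior art, ym-ir-lit-1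
2026-08-27; typed layer `Literature/MathematicalPhysics/QuantumFieldTheory/KandelDomanyRepresentation.lean`, p587056,
to be imported by the rung's proof; what is specific here is the hard-core polymer PACKAGING with clauses (P)(I)(D)).  ENGINE (`stub_polymerEngine`, provable): a universal `p₀ > 0` (Kotecký–Preiss threshold
for radius-6 cell animals in `ℤ⁴`) such that `DPR` with `p ≤ p₀` at physical mesh `⌈ℓ/a β⌉` for all large `β`, `S`
gives `GapInUnits` with rate `∝ a/ℓ`.  CRUX (`stub_polymerCert : IRPolymerCert`): for compact SIMPLE `G`,
`LowerBounds` ⇒ for every `p > 0` the representation exists at some physical mesh `ℓ(p)`, eventually in `β`.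

**Why this line / why novel.**  The only certificate formats on the desk are kernel/TV with a boundary datum (8895,
L2″ v6–v10 — three deaths by boundary constructions), block heat-bath Poincaré (ym19354-3) and AF-onset splits
(af-pincer).  `DPR` is a MEASURE-LEVEL ∃-coupling: no boundary datum is quantified (nothing for wire/film/adversarial
data to hit), no positivity is used (escape hatch E3 «convergent expansions / non-product structure» of the Toron
barrier), no centre (IR ranges over `G₂, F₄, E₈`), and its engine is polymer COUNTING, not an expansion of the
Boltzmann weight in `β` (census B5's KP is an input format here, not a claim that the weight expands at weak
coupling: the activities are probabilities of non-decoupling events, small when cells beat the correlation length).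

**bears_on:** LADDER-YM R2c · leaf `Summit.QuantumFields.YangMills.Theses.BalabanLadder.IR` (stmt-QuantumFields-19354).
**Honesty.** Nothing here proves the Clay YM mass gap; `stub_polymerCert` IS the weak-coupling gap in polymer clothes
(stronger than `GapInUnits`; priced XL); R4 closes only the conditional finite-𝕋⁴ rung `BalabanLadder.UV`.  No
weak-coupling CONSTRUCTION of the coupling is proposed: the naive one (decimate to cell-boundary links + ES on cell
partition functions) meets wall stiffness `sup/inf Z_c = e^{O(β b³)}` and collapses to the tempered format — recorded
as a dead end, not hidden.
**Cheapest falsifier / INSTRUMENT (eng-4 door portrait, eng-2 tiny tori).** (F1) the «ES-polymer door»: the largest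
`β_W` at which `(e^{12nβ} − 1)·e·13⁴ < 1` (mesh-1 KP for radius-6 animals; tree coupling β = β_W/n) — a certified
rational, expected `≈ 10⁻⁶`-`10⁻⁵`, to sit on the portrait next to the KP door `2.56e-7`; if it does NOT beat the KP
door the rung is pointless as an instrument (the line survives, the door does not); (F2) consistency: wherever eng-2
has an exact tiny-torus TM gap, `gap_TM ≥ −log(C p(β))/const` must not be violated by the rung's explicit `p(β)`;
(F3, kernel, done by the ideator) `#h21_crux_probe` on `IRPolymerCert`, `PolymerEngine`, `ESRung`.

**RE-BASED (lead ym-ir-line-mxc-p1 g2, R366 pooled tasks, after p596710):** the vocabulary (§1 grids/cells/blocks, §2 polymers /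
compatibility / owners, §3 `DPR`, `DPRInUnits`, `PolymerEngine`, `IRPolymerCert`, `ESRung`, composition `irCal_of_polymer` /
`ir_of_polymer`) is now the tree module `Summits/QuantumFields/YangMills/Theorems/IR/EsPolymerDefs.lean` (Mathlib `DependsOn f E`
replaces the private predicate); this skeleton is `import` + the three stubs + `IR_of := ir_of_polymer stub_polymerEngine
stub_polymerCert`.  First engine inputs landed: `Theorems/IR/EsPolymerDecoupling.lean` (covariances reduce to the hard-core gas;
Peierls).  NOT re-registered on the crux by the lead (the registered skeleton of record is the merged maxcorr line's).
**RUNG LANDED (lead g2, p599404 `Theorems/IR/EsPolymerESRung.lean`, on `…EsPolymerESMeasures` p598873, `…EsPolymerTorusCells`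
p598115, `…EsPolymerDecoupling` p597116):** `stub_esRung` is the tree theorem `EsPolymer.stub_esRung : ESRung` (Edwards–Sokal /
Kandel–Domany cell deletion at mesh 1; clauses (P)(I)(D) by finite-range independence of product Haar), imported below.  Open
stubs: `stub_polymerEngine` (REPORTED MISSTATED — evidence `stub-misstated-polymerEngine.md`: clauses (I)(D) at block radius 1
cannot feed `GapInUnits` for observables of arbitrary finite support; proposed repair DPRk = clauses at every block radius k),
`stub_polymerCert` (XL load, unstaffed).
**RESHAPED (lead g2, L4, v4):** the misstated engine is replaced.  New tree constants `Theorems/IR/EsPolymerDefsK.lean`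
(p600125): `nearFamily Γ c k` (polymers within `k+1` of `c`), `DPRk` = `DPR` with clauses (I)(D) at EVERY block radius `k`
((I)_k: blocks `≥ 2k+2` apart with DISJOINT near families are exactly independent under `ν_Γ`; (D)_k: the `ν_Γ`-mean of a
radius-`k` block observable is `ν_Γ(1)·Φ(nearFamily Γ c k)`), `DPRkInUnits`, `PolymerEngineK` (L, provable: KP mixing of the
hard-core cell gas + Peierls tail of a polymer near both blocks), `IRPolymerCertK` (XL load, NOT staffed, stronger than the
crux), `ESRungK`, and the by-name composition `ir_of_polymerK`; the refinement `dpr_of_dprk : DPRk ⇒ DPR`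
(`Theorems/IR/EsPolymerDPRkRefines.lean`); the radius-`k` rung `stub_esRungK : ESRungK` is LANDED
(`Theorems/IR/EsPolymerESRungK.lean`).  Stubs now: `stub_polymerEngineK` (open, L), `stub_polymerCertK` (XL load, unstaffed);
`IR_of := ir_of_polymerK stub_polymerEngineK stub_polymerCertK`.  The v3 stubs `stub_polymerEngine` (misstated) and
`stub_polymerCert` (superseded by the stronger K-load) are withdrawn from this skeleton.
**ENGINE LANDED (v5, lead ym-ir-line-mxc-p1 g3):** `stub_polymerEngineK : PolymerEngineK` is now PROVED below by the tree theorem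
`EsPolymer.EngineK.polymerEngineK` (`Theorems/IR/EsPolymerEngineK.lean`, p608147, ideator ym-ir-idea-1 g7 in the g9-№2 helper lane;
threshold `p₀ = (4(13⁴+1)²)⁻²`, rate `log(2(13⁴+1)²)/(12(ℓ+1))`), assembled from the species ↦ block bookkeeping
(`Theorems/IR/EsPolymerGridCellsK.lean` p607513; the lead's parallel `Theorems/IR/EsPolymerGridCells.lean` p607022 is an equivalent
alternative typing of input (d) on `frameIdx`) and the block clustering bound `GasMixing.abs_blockCov_le_pow`
(`Theorems/IR/EsPolymerGasMixingK.lean` p605664, on `…GasSwapK` p605156, `…GasPeierls2K` p605525 and the lead's `…GasReductionK` p601143 /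
`…PeierlsTailK` p601889 / `…CovBoundK` p602413).  (The lead's own assembly, p608141, reached the gate seconds after p608147 at the same
target and was withdrawn as a duplicate.)  Open stubs now: ONLY the unstaffed XL load `stub_polymerCertK` (R366 (i)); the engine (L),
the rungs `stub_esRung` / `stub_esRungK` and the refinement `dpr_of_dprk` are all tree theorems — the line is now exactly its load.
NOT re-registered (RULING g9-№1: the registered skeleton of record on the item is the LEAD ab-p1's).

**COFINAL RE-CUT (lead g5, v6; director-ym №25 (2) after the leaf re-typing R423/R424, route rev 12):** the deciding leaf is now
`Theses.BalabanLadder.IRcof` (stmt-QuantumFields-26930).  RE-PRICED: WALL UNCHANGED — the engine is PER-COUPLING (`EngineK.gapOn_of_DPRkOn`,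
p619095 `Theorems/IR/EsPolymerEngineKCofinal.lean`), so the line closes `IRcof` BY NAME modulo the COFINAL load `IRPolymerCertKCof`
(weaker than `IRPolymerCertK`: `EngineK.polymerCertKCof_of_irPolymerCertK`) — companion skeleton `Lines/es_polymer_decoupling_cofinal.lean`
(one sorry).  THIS file (old leaf `IR`, load of record `stub_polymerCertK`) is unchanged below.
-/

set_option autoImplicit false

noncomputable section

namespace Summit.QuantumFields.YangMills.Cruxes.IR.EsPolymer

/-- stub 1′ — THE ENGINE, reshaped (abstract two-region mixing of the hard-core cell gas + clauses (I)_k (D)_k + the Peierls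
tail of a polymer near both blocks ⇒ `GapInUnits`, rate uniform in the species; L): **PROVED** — the tree theorem
`EsPolymer.EngineK.polymerEngineK` (`Theorems/IR/EsPolymerEngineK.lean`, p608147). -/
theorem stub_polymerEngineK : PolymerEngineK :=
  EngineK.polymerEngineK

/-- stub 2′ — THE LOAD, reshaped (R2c in decoupling–polymer form with clauses at every block radius; simplicity
load-bearing; XL, NOT staffed; stronger than the crux). -/
theorem stub_polymerCertK : IRPolymerCertK := by
  sorry

-- stub 3 — BC5 FORMAT RUNG `stub_esRung : ESRung`: LANDED (p599404, `Theorems/IR/EsPolymerESRung.lean`), imported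
-- (tree theorem `Summit.QuantumFields.YangMills.Cruxes.IR.EsPolymer.stub_esRung`; not used by `IR_of`).
example : ESRung := stub_esRung

-- stub 3′ — RUNG at every block radius `stub_esRungK : ESRungK`: LANDED (`Theorems/IR/EsPolymerESRungK.lean`), imported;
-- and the reshaped format refines the original (`Theorems/IR/EsPolymerDPRkRefines.lean`).
example : ESRungK := stub_esRungK
example : ESRungK → ESRung := esRung_of_esRungK

/-- **The line concludes the route decl BY NAME:** `PolymerEngineK → IRPolymerCertK → BalabanLadder.IR` (tree
`ir_of_polymerK`, real proof; the engine is a tree theorem, the load `stub_polymerCertK` is the only `sorry`). -/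
theorem IR_of : Summit.QuantumFields.YangMills.Theses.BalabanLadder.IR :=
  ir_of_polymerK stub_polymerEngineK stub_polymerCertK

end Summit.QuantumFields.YangMills.Cruxes.IR.EsPolymer

end
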